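import Literature.Analysis.FluidPDE.NSGalerkinCrossIdentity
import Literature.Analysis.FluidPDE.NSGalerkinTimeBookkeeping
import HarnessLib

/-!
# The energy inequality for the difference of a Leray–Hopf solution and a Galerkin trajectory
  on the flat torus

Analysis/FluidPDE support file (file 4 of the discharge of
`Literature.Analysis.FluidPDE.galerkin_tendsto_lerayHopf_torus2`, `NSEnstrophyBalance2DGalerkin`;
Foias–Manley–Rosa–Temam 2001, Ch. II Thm. 7.3). Serrin's weak–strong energy method (Serrin 1963,
§4; Robinson–Rodrigo–Sadowski 2016, Lemma 8.18 and (8.12)) with the Galerkin trajectory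
`U = galerkinVelocity S α` (steady smooth force `f`, datum `P_S u₀`) as the strong solution: for a
Leray–Hopf solution `u` on `T^d × [0,T)` with force `f` and datum `u₀ ∈ L²`, writing `w = u - U`,
`P_S` for the `S`-truncation and `G = P_S f` for the Galerkin force, for every `t ∈ (0, T]`

`∫|w(t)|² + 2ν ∫₀ᵗ D ≤ ∫|u₀ - U(0)|² + 2∫₀ᵗ ( ∫⟪f - G, u⟫ - ∫⟪w, (w·∇)U⟫ - ∫⟪u - P_S u, (U·∇)U⟫ )`

(`Torus.IsLerayHopfOn.galerkin_difference_energy_le`), where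
`D(s) = ‖∇u(s)‖₂² + ‖∇U(s)‖₂² + 2∫⟪u(s), ΔU(s)⟫` is the dissipation `‖∇w(s)‖₂²` whenever
`‖∇u(s)‖₂ < ∞` (`toReal_eGradNormSq_sub_realTrigPoly`, previous file), valid in every dimension.

Proof: `|w|² = |u|² + |U|² - 2(u, U)`; the energy inequality of `u` from `0` (clause
`energy_ineq_zero`), the exact energy identity of the Galerkin trajectory
(`galerkin_energy_identity`) and the cross identity
(`Torus.IsLerayHopfOn.galerkin_cross_identity`, with `α' = galerkinRHS S ν f̂|_S ∘ α`) are
added; under the time integral the Galerkin time derivative paired with `u(s)` is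
`-∫⟪P_S u,(U·∇)U⟫ + ν∫⟪u, ΔU⟫ + ∫⟪G, P_S u⟫` (`integral_inner_galerkinRHS_eq`, valid because `u(s)`
is weakly divergence free at every `s ∈ (0, T]`), the force terms combine to `∫⟪f - G, u⟫`
(`∫⟪G, U⟫ = ∫⟪f, U⟫`, `∫⟪G, P_S u⟫ = ∫⟪G, u⟫`), the Laplacian terms to `2ν∫⟪u, ΔU⟫`, and the two
trilinear terms rearrange (`inner_apply_sub_inner_apply_eq`) into
`∫⟪U,(w·∇)U⟫ + ∫⟪w,(w·∇)U⟫ + ∫⟪u - P_S u,(U·∇)U⟫`, the first of which vanishes because `w(s)` is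
weakly divergence free (`Torus.integral_inner_self_convect_eq_zero_of_isWeaklyDivFree`;
Foias–Manley–Rosa–Temam 2001, (A.44)).

## References

* J. Serrin, *The initial value problem for the Navier–Stokes equations* (1963), §4.
* J. C. Robinson, J. L. Rodrigo, W. Sadowski, *The three-dimensional Navier–Stokes equations*,
  CUP 2016, Lemma 8.18, (8.12), proof of Thm. 6.10.
* C. Foias, O. Manley, R. Rosa, R. Temam, *Navier–Stokes Equations and Turbulence*, CUP 2001,
  Ch. II §7, Thm. 7.3, p. 70; App. II.A (A.44)–(A.45), (A.52).
-/

noncomputable section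

open MeasureTheory TopologicalSpace Set Function Filter UnitAddTorus
open scoped InnerProductSpace RealInnerProductSpace ENNReal NNReal Topology

namespace Literature.Analysis.FluidPDE

open FunctionSpaces.Torus Torus

section General

variable {d : Type*} [Fintype d] [DecidableEq d]

omit [DecidableEq d] in
/-- `∫ ‖a - b‖² = ∫ ‖a‖² - 2 ∫ ⟪a, b⟫ + ∫ ‖b‖²` for `a ∈ L²` and a continuous `b` on the torus. [folklore] -/
theorem integral_norm_sub_sq_eq {a b : UnitAddTorus d → EuclideanSpace ℝ d} (ha : MemLp a 2 volume)
    (hb : Continuous b) :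
    ∫ x, ‖a x - b x‖ ^ 2 = (∫ x, ‖a x‖ ^ 2) - 2 * (∫ x, ⟪a x, b x⟫) + ∫ x, ‖b x‖ ^ 2 := by
  have hbm : MemLp b 2 volume := hb.memLp_of_hasCompactSupport (HasCompactSupport.of_compactSpace b)
  have i1 := ha.integrable_norm_pow two_ne_zero
  have i2 : Integrable (fun x => ⟪a x, b x⟫) volume := integrable_inner_of_continuous (ha.integrable one_le_two) hb
  have i3 := hbm.integrable_norm_pow two_ne_zero
  have hpt : ∀ x, ‖a x - b x‖ ^ 2 = ‖a x‖ ^ 2 - 2 * ⟪a x, b x⟫ + ‖b x‖ ^ 2 := fun x => norm_sub_sq_real _ _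
  have i12 : Integrable (fun x => ‖a x‖ ^ 2 - 2 * ⟪a x, b x⟫) volume := i1.sub (i2.const_mul 2)
  simp_rw [hpt]
  rw [integral_add i12 i3, integral_sub i1 (i2.const_mul 2), integral_const_mul]

omit [DecidableEq d] in
/-- A steady `L²` force is square integrable on every finite slab: `∫₀ᵀ ∫⁻ ‖f‖ₑ² < ∞`. [folklore] -/
theorem lintegral_lintegral_enorm_sq_const_lt_top {f : UnitAddTorus d → EuclideanSpace ℝ d}
    (hf : MemLp f 2 volume) (T : ℝ) :
    ∫⁻ _ in Ioo 0 T, ∫⁻ x, ‖f x‖ₑ ^ 2 < ⊤ := by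
  rw [setLIntegral_const]
  refine ENNReal.mul_lt_top ?_ measure_Ioo_lt_top
  rw [lintegral_enorm_sq_eq_ofReal hf]
  exact ENNReal.ofReal_lt_top

end General

/-! ### The energy inequality for `w = u - U` -/

section Difference

variable {d : Type*} [Fintype d] [DecidableEq d]

variable {T ν : ℝ} {S : Finset (d → ℤ)} {f u₀ : UnitAddTorus d → EuclideanSpace ℝ d}
  {u : ℝ → UnitAddTorus d → EuclideanSpace ℝ d} {α : ℝ → ↥S → EuclideanSpace ℂ d}

/-- **The energy inequality for the difference of a Leray–Hopf solution and a Galerkin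
trajectory** (Serrin 1963, §4; Robinson–Rodrigo–Sadowski 2016, (8.12) with the Galerkin
approximation as strong solution; Foias–Manley–Rosa–Temam 2001, Thm. 7.3 "the equation satisfied
by the difference of two solutions"). Let `f` be smooth and steady, `u₀ ∈ L²`, `u` a Leray–Hopf
solution on `T^d × [0,T)`, `T > 0`, with these data, and `α` a Galerkin trajectory of order `S`
(`IsGalerkinTrajectory ν S f u₀ α`) with velocity `U = galerkinVelocity S α`; write
`P_S v = realTrigPoly S v̂` and `G = realTrigPoly S (f̂|_S)‾`. Then for every `t ∈ (0, T]`
`∫‖u(t) - U(t)‖² + 2ν ∫_{(0,t]} (‖∇u‖₂² + ‖∇U‖₂² + 2∫⟪u, ΔU⟫) ds ≤ ∫‖u₀ - U(0)‖²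
  + 2 ∫_{(0,t]} ( ∫⟪f - G, u⟫ - ∫⟪u - U, ((u - U)·∇)U⟫ - ∫⟪u - P_S u, (U·∇)U⟫ ) ds`. [cite: RobinsonRodrigoSadowski2016, Lemma 8.18, (8.12)] -/
theorem IsGalerkinTrajectory.difference_energy_le (h : IsGalerkinTrajectory ν S f u₀ α)
    (hu : Torus.IsLerayHopfOn T ν (fun _ => f) u₀ u) (hT : 0 < T)
    (hf : FunctionSpaces.Torus.IsSmooth f) (hu₀ : MemLp u₀ 2 volume) {t : ℝ} (ht : t ∈ Ioc 0 T) :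
    (∫ x, ‖u t x - galerkinVelocity S α t x‖ ^ 2) +
        2 * ν * ∫ s in Ioc 0 t, ((eGradNormSq (u s)).toReal + (eGradNormSq (galerkinVelocity S α s)).toReal +
          2 * ∫ x, ⟪u s x, FunctionSpaces.Torus.laplacian (galerkinVelocity S α s) x⟫) ≤
      (∫ x, ‖u₀ x - galerkinVelocity S α 0 x‖ ^ 2) +
        2 * ∫ s in Ioc 0 t,
          ((∫ x, ⟪f x - realTrigPoly S (coeffExt S (fourierRestrict S f)) x, u s x⟫) -
            (∫ x, ⟪u s x - galerkinVelocity S α s x,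
              FunctionSpaces.Torus.convect (u s - galerkinVelocity S α s) (galerkinVelocity S α s) x⟫) -
            ∫ x, ⟪u s x - realTrigPoly S (fun l => mFourierCoeff
                (FunctionSpaces.EuclideanSpace.complexify ∘ u s) l) x,
              FunctionSpaces.Torus.convect (galerkinVelocity S α s) (galerkinVelocity S α s) x⟫) := by
  -- notation and basic facts
  have hS := h.symm
  set U : ℝ → UnitAddTorus d → EuclideanSpace ℝ d := galerkinVelocity S α with hU_def
  have hU : ∀ s, U s = realTrigPoly S (coeffExt S (α s)) := fun s => rfl
  set G : UnitAddTorus d → EuclideanSpace ℝ d := realTrigPoly S (coeffExt S (fourierRestrict S f)) with hG_def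
  set Pu : ℝ → UnitAddTorus d → EuclideanSpace ℝ d := fun s =>
    realTrigPoly S (fun l => mFourierCoeff (FunctionSpaces.EuclideanSpace.complexify ∘ u s) l) with hPu_def
  have hUs : ∀ s, FunctionSpaces.Torus.IsSmooth (U s) := fun s => isSmooth_realTrigPoly S _
  have hreal : ∀ s, IsRealCoeff (α s) := fun s => (h.mem s).1
  have hgr : IsRealCoeff (fourierRestrict S f) := isRealCoeff_mFourierCoeff hf.integrable
  have hG : FunctionSpaces.Torus.IsSmooth G := isSmooth_realTrigPoly S _
  have hαT : ContinuousOn α (Icc 0 T) := h.continuousOn.mono Icc_subset_Ici_self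
  have htT : Ioc 0 t ⊆ Ioc 0 T := Ioc_subset_Ioc_right ht.2
  have hmem : ∀ s ∈ Ioc 0 t, MemLp (u s) 2 volume := fun s hs => hu.memLp s ⟨hs.1.le, hs.2.trans ht.2⟩
  have hfm := aestronglyMeasurable_stLift_const hf (volume.restrict (Ioo 0 T ×ˢ univ))
  have hf₂ := lintegral_lintegral_enorm_sq_const_lt_top (hf.memLp 2) T
  -- (1) the energy inequality of `u` from `0`
  have hE1 := hu.energy_ineq_zero t ⟨ht.1.le, ht.2⟩
  -- (2) the energy identity of the Galerkin trajectory
  have hE2 : FunctionSpaces.Torus.kineticEnergy (U t) + ν * (∫⁻ τ in Ioo 0 t, eGradNormSq (U τ)).toReal =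
      FunctionSpaces.Torus.kineticEnergy (U 0) + ∫ τ in (0 : ℝ)..t, ∫ x, ⟪G x, U τ x⟫ :=
    galerkin_energy_identity ν hS (g := fun _ => fourierRestrict S f) continuous_const
      (fun _ => hgr) h.mem h.hasDerivWithinAt le_rfl ht.1.le
  -- (3) the cross identity
  obtain ⟨-, -, hX⟩ := hu.galerkin_cross_identity hT hfm hf₂ (hu₀.integrable one_le_two) hS
    (α' := fun s => galerkinRHS S ν (fourierRestrict S f) (α s)) (fun s _ => h.mem s)
    (fun s _ => galerkinRHS_mem ν hS hgr (h.mem s)) (h.hasDerivWithinAt T)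
    (ContinuousOn.galerkinRHS ν continuousOn_const hαT)
  have hXt : (∫ x, ⟪u t x, U t x⟫) = (∫ x, ⟪u₀ x, U 0 x⟫) + ∫ s in Ioc 0 t,
      ((∫ x, ⟪u s x, realTrigPoly S (coeffExt S (galerkinRHS S ν (fourierRestrict S f) (α s))) x⟫) +
        ∫ x, (⟪u s x, FunctionSpaces.Torus.convect (u s) (U s) x⟫ +
          ν * ⟪u s x, FunctionSpaces.Torus.laplacian (U s) x⟫ + ⟪f x, U s x⟫)) := hX t ht
  -- slices
  have hdiv : ∀ s ∈ Ioc 0 t, FunctionSpaces.Torus.IsWeaklyDivFree (u s) := fun s hs =>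
    hu.isWeaklyDivFree_of_mem_Ioc (htT hs)
  have hUwdf : ∀ s, FunctionSpaces.Torus.IsWeaklyDivFree (U s) := fun s =>
    (galerkin_slice_props hS (h.mem s)).2.2.1
  -- (4) the Galerkin time derivative paired with `u s`
  have hIs : ∀ s ∈ Ioc 0 t,
      (∫ x, ⟪u s x, realTrigPoly S (coeffExt S (galerkinRHS S ν (fourierRestrict S f) (α s))) x⟫) =
        -(∫ x, ⟪Pu s x, FunctionSpaces.Torus.convect (U s) (U s) x⟫) +
          ν * (∫ x, ⟪u s x, FunctionSpaces.Torus.laplacian (U s) x⟫) + ∫ x, ⟪G x, Pu s x⟫ :=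
    fun s hs => integral_inner_galerkinRHS_eq hS (h.mem s) hgr (hmem s hs) (hdiv s hs)
  -- (5) the flux, split into its three terms
  have hFl : ∀ s ∈ Ioc 0 t,
      (∫ x, (⟪u s x, FunctionSpaces.Torus.convect (u s) (U s) x⟫ +
          ν * ⟪u s x, FunctionSpaces.Torus.laplacian (U s) x⟫ + ⟪f x, U s x⟫)) =
        (∫ x, ⟪u s x, FunctionSpaces.Torus.convect (u s) (U s) x⟫) +
          ν * (∫ x, ⟪u s x, FunctionSpaces.Torus.laplacian (U s) x⟫) + ∫ x, ⟪f x, U s x⟫ := by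
    intro s hs
    have i1 : Integrable (fun x => ⟪u s x, FunctionSpaces.Torus.convect (u s) (U s) x⟫) volume :=
      integrable_inner_convect_self (hmem s hs) (hUs s)
    have i2 : Integrable (fun x => ⟪u s x, FunctionSpaces.Torus.laplacian (U s) x⟫) volume :=
      integrable_inner_of_continuous ((hmem s hs).integrable one_le_two) (hUs s).laplacian.continuous
    have i3 : Integrable (fun x => ⟪f x, U s x⟫) volume :=
      integrable_inner_of_continuous hf.integrable (hUs s).continuous
    have i12 : Integrable (fun x => ⟪u s x, FunctionSpaces.Torus.convect (u s) (U s) x⟫ +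
        ν * ⟪u s x, FunctionSpaces.Torus.laplacian (U s) x⟫) volume := i1.add (i2.const_mul ν)
    rw [integral_add i12 i3, integral_add i1 (i2.const_mul ν), integral_const_mul]
  -- (6) the force terms
  have hΦ3 : ∀ s, (∫ x, ⟪f x, U s x⟫) = ∫ x, ⟪G x, U s x⟫ := fun s =>
    integral_inner_force_realTrigPoly_coeffExt hS (hf.memLp 2) (hreal s)
  have hΦG : ∀ s ∈ Ioc 0 t, (∫ x, ⟪G x, Pu s x⟫) = ∫ x, ⟪G x, u s x⟫ := fun s hs =>
    integral_inner_galerkinForce_truncation hS hf.integrable (hmem s hs)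
  -- (7) the trilinear terms
  have hNl : ∀ s ∈ Ioc 0 t,
      (∫ x, ⟪u s x, FunctionSpaces.Torus.convect (u s) (U s) x⟫) -
          ∫ x, ⟪Pu s x, FunctionSpaces.Torus.convect (U s) (U s) x⟫ =
        (∫ x, ⟪u s x - U s x, FunctionSpaces.Torus.convect (u s - U s) (U s) x⟫) +
          ∫ x, ⟪u s x - Pu s x, FunctionSpaces.Torus.convect (U s) (U s) x⟫ := by
    intro s hs
    have hu2 : MemLp (u s) 2 volume := hmem s hs
    have hU2 : MemLp (U s) 2 volume := (hUs s).memLp 2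
    have hP2 : MemLp (Pu s) 2 volume := memLp_realTrigPoly S _ 2
    have hw2 : MemLp (u s - U s) 2 volume := hu2.sub hU2
    have hr2 : MemLp (u s - Pu s) 2 volume := hu2.sub hP2
    have iNl : Integrable (fun x => ⟪u s x, FunctionSpaces.Torus.convect (u s) (U s) x⟫) volume :=
      integrable_inner_convect' hu2 hu2 (hUs s)
    have iBp : Integrable (fun x => ⟪Pu s x, FunctionSpaces.Torus.convect (U s) (U s) x⟫) volume :=
      integrable_inner_convect' hP2 hU2 (hUs s)
    have iT0 : Integrable (fun x => ⟪U s x, FunctionSpaces.Torus.convect (u s - U s) (U s) x⟫) volume :=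
      integrable_inner_convect' hU2 hw2 (hUs s)
    have iB1 : Integrable (fun x => ⟪u s x - U s x, FunctionSpaces.Torus.convect (u s - U s) (U s) x⟫) volume :=
      integrable_inner_convect' (p := u s - U s) hw2 hw2 (hUs s)
    have iB2 : Integrable (fun x => ⟪u s x - Pu s x, FunctionSpaces.Torus.convect (U s) (U s) x⟫) volume :=
      integrable_inner_convect' (p := u s - Pu s) hr2 hU2 (hUs s)
    have hpt : ∀ x, ⟪u s x, FunctionSpaces.Torus.convect (u s) (U s) x⟫ -
        ⟪Pu s x, FunctionSpaces.Torus.convect (U s) (U s) x⟫ =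
        ⟪U s x, FunctionSpaces.Torus.convect (u s - U s) (U s) x⟫ +
          ⟪u s x - U s x, FunctionSpaces.Torus.convect (u s - U s) (U s) x⟫ +
          ⟪u s x - Pu s x, FunctionSpaces.Torus.convect (U s) (U s) x⟫ := fun x =>
      inner_apply_sub_inner_apply_eq (FunctionSpaces.Torus.fderiv (U s) x) (u s x) (U s x) (Pu s x)
    have hT0 : ∫ x, ⟪U s x, FunctionSpaces.Torus.convect (u s - U s) (U s) x⟫ = 0 :=
      integral_inner_self_convect_eq_zero_of_isWeaklyDivFree
        (Torus.IsWeaklyDivFree.sub' (hdiv s hs) (hUwdf s) (hu2.integrable one_le_two)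
          (hU2.integrable one_le_two)) (hUs s)
    have iT01 : Integrable (fun x => ⟪U s x, FunctionSpaces.Torus.convect (u s - U s) (U s) x⟫ +
        ⟪u s x - U s x, FunctionSpaces.Torus.convect (u s - U s) (U s) x⟫) volume := iT0.add iB1
    rw [← integral_sub iNl iBp, integral_congr_ae (ae_of_all _ hpt),
      integral_add iT01 iB2, integral_add iT0 iB1, hT0, zero_add]
  -- (8) the integrand of the cross identity, rearranged
  have hint : ∀ s ∈ Ioc 0 t,
      (∫ x, ⟪u s x, realTrigPoly S (coeffExt S (galerkinRHS S ν (fourierRestrict S f) (α s))) x⟫) +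
          ∫ x, (⟪u s x, FunctionSpaces.Torus.convect (u s) (U s) x⟫ +
            ν * ⟪u s x, FunctionSpaces.Torus.laplacian (U s) x⟫ + ⟪f x, U s x⟫) =
        2 * ν * (∫ x, ⟪u s x, FunctionSpaces.Torus.laplacian (U s) x⟫) +
          ((∫ x, ⟪G x, u s x⟫) + ∫ x, ⟪G x, U s x⟫) +
          ((∫ x, ⟪u s x - U s x, FunctionSpaces.Torus.convect (u s - U s) (U s) x⟫) +
            ∫ x, ⟪u s x - Pu s x, FunctionSpaces.Torus.convect (U s) (U s) x⟫) := by
    intro s hs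
    rw [hIs s hs, hFl s hs, hΦ3 s, hΦG s hs, ← hNl s hs]
    ring
  -- (9) integrability on `(0, t]` of the time integrands
  have hIoc : ∀ {F : ℝ → ℝ}, IntegrableOn F (Ioo 0 T) → IntegrableOn F (Ioc 0 t) := fun hF =>
    integrableOn_Ioc_of_integrableOn_Ioo hF ht.2
  have hL_int : IntegrableOn (fun s => ∫ x, ⟪u s x, FunctionSpaces.Torus.laplacian (U s) x⟫) (Ioc 0 t) :=
    hIoc (hu.integrableOn_integral_inner_laplacian_galerkin hαT)
  have hΦG_int : IntegrableOn (fun s => ∫ x, ⟪G x, u s x⟫) (Ioc 0 t) := by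
    refine hIoc ((hu.integrableOn_integral_inner hG.continuous).congr_fun (fun s _ => ?_) measurableSet_Ioo)
    exact integral_congr_ae (ae_of_all _ fun x => real_inner_comm _ _)
  have hΦ1_int : IntegrableOn (fun s => ∫ x, ⟪f x, u s x⟫) (Ioc 0 t) := by
    refine hIoc ((hu.integrableOn_integral_inner hf.continuous).congr_fun (fun s _ => ?_) measurableSet_Ioo)
    exact integral_congr_ae (ae_of_all _ fun x => real_inner_comm _ _)
  have hΦ2_cont : ContinuousOn (fun s => ∫ x, ⟪G x, U s x⟫) (Icc 0 T) := by
    have heq : ∀ s, (∫ x, ⟪G x, U s x⟫) =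
        ∑ k ∈ S, (inner ℂ (coeffExt S (fourierRestrict S f) k) (coeffExt S (α s) k)).re := fun s =>
      integral_inner_realTrigPoly_realTrigPoly hS (hgr.isConjSymm_coeffExt hS) ((hreal s).isConjSymm_coeffExt hS)
    simp_rw [heq]
    refine continuousOn_finsetSum _ fun k _ => Complex.continuous_re.comp_continuousOn ?_
    exact continuousOn_const.inner (continuousOn_coeffExt_apply hαT k)
  have hΦ2_int : IntegrableOn (fun s => ∫ x, ⟪G x, U s x⟫) (Ioc 0 t) :=
    (hΦ2_cont.integrableOn_Icc.mono_set (Icc_subset_Icc_right ht.2)).mono_set Ioc_subset_Icc_self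
  have hB1_int : IntegrableOn (fun s => ∫ x, ⟪u s x - U s x,
      FunctionSpaces.Torus.convect (u s - U s) (U s) x⟫) (Ioc 0 t) :=
    hIoc (hu.integrableOn_trilinear_sub_galerkin hαT)
  have hB2_int : IntegrableOn (fun s => ∫ x, ⟪u s x - Pu s x,
      FunctionSpaces.Torus.convect (U s) (U s) x⟫) (Ioc 0 t) :=
    hIoc (hu.integrableOn_truncation_trilinear_galerkin hS hαT fun s _ => hreal s)
  -- the cross identity integrated
  have hXint : ∫ s in Ioc 0 t,
      ((∫ x, ⟪u s x, realTrigPoly S (coeffExt S (galerkinRHS S ν (fourierRestrict S f) (α s))) x⟫) +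
        ∫ x, (⟪u s x, FunctionSpaces.Torus.convect (u s) (U s) x⟫ +
          ν * ⟪u s x, FunctionSpaces.Torus.laplacian (U s) x⟫ + ⟪f x, U s x⟫)) =
      2 * ν * (∫ s in Ioc 0 t, ∫ x, ⟪u s x, FunctionSpaces.Torus.laplacian (U s) x⟫) +
        ((∫ s in Ioc 0 t, ∫ x, ⟪G x, u s x⟫) + ∫ s in Ioc 0 t, ∫ x, ⟪G x, U s x⟫) +
        ((∫ s in Ioc 0 t, ∫ x, ⟪u s x - U s x, FunctionSpaces.Torus.convect (u s - U s) (U s) x⟫) +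
          ∫ s in Ioc 0 t, ∫ x, ⟪u s x - Pu s x, FunctionSpaces.Torus.convect (U s) (U s) x⟫) := by
    have j1 : IntegrableOn (fun s => (∫ x, ⟪G x, u s x⟫) + ∫ x, ⟪G x, U s x⟫) (Ioc 0 t) := hΦG_int.add hΦ2_int
    have j2 : IntegrableOn (fun s => 2 * ν * (∫ x, ⟪u s x, FunctionSpaces.Torus.laplacian (U s) x⟫) +
        ((∫ x, ⟪G x, u s x⟫) + ∫ x, ⟪G x, U s x⟫)) (Ioc 0 t) := (hL_int.const_mul _).add j1
    have j3 : IntegrableOn (fun s => (∫ x, ⟪u s x - U s x, FunctionSpaces.Torus.convect (u s - U s) (U s) x⟫) +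
        ∫ x, ⟪u s x - Pu s x, FunctionSpaces.Torus.convect (U s) (U s) x⟫) (Ioc 0 t) := hB1_int.add hB2_int
    rw [setIntegral_congr_fun measurableSet_Ioc hint, integral_add j2 j3, integral_add (hL_int.const_mul _) j1,
      integral_const_mul, integral_add hΦG_int hΦ2_int, integral_add hB1_int hB2_int]
  -- (10) the dissipations as Bochner integrals
  have hDu : (∫⁻ τ in Ioo 0 t, eGradNormSq (u τ)).toReal = ∫ s in Ioc 0 t, (eGradNormSq (u s)).toReal := by
    have hmeas : AEMeasurable (fun τ => eGradNormSq (u τ)) (volume.restrict (Ioo 0 t)) :=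
      hu.aemeasurable_eGradNormSq.mono_measure (Measure.restrict_mono (Ioo_subset_Ioo_right ht.2) le_rfl)
    have hfin : ∫⁻ τ in Ioo 0 t, eGradNormSq (u τ) ≠ ⊤ :=
      ne_top_of_le_ne_top hu.lintegral_eGradNormSq_lt_top.ne (lintegral_mono_set (Ioo_subset_Ioo_right ht.2))
    rw [← integral_toReal hmeas (ae_lt_top' hmeas hfin), integral_Ioc_eq_integral_Ioo]
  have hEU_cont : ContinuousOn (fun s => (eGradNormSq (U s)).toReal) (Icc 0 T) :=
    continuousOn_toReal_eGradNormSq_galerkin hS hαT fun s _ => hreal s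
  have hDU : (∫⁻ τ in Ioo 0 t, eGradNormSq (U τ)).toReal = ∫ s in Ioc 0 t, (eGradNormSq (U s)).toReal := by
    have heq : (fun τ => eGradNormSq (U τ)) = fun τ => ENNReal.ofReal ((eGradNormSq (U τ)).toReal) :=
      funext fun τ => (ENNReal.ofReal_toReal (h.eGradNormSq_ne_top τ)).symm
    have hmeas : AEMeasurable (fun τ => eGradNormSq (U τ)) (volume.restrict (Ioo 0 t)) := by
      rw [heq]
      exact ENNReal.measurable_ofReal.comp_aemeasurable
        ((hEU_cont.mono (Ioo_subset_Icc_self.trans (Icc_subset_Icc_right ht.2))).aestronglyMeasurable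
          measurableSet_Ioo).aemeasurable
    rw [← integral_toReal hmeas (ae_of_all _ fun τ => (h.eGradNormSq_ne_top τ).lt_top),
      integral_Ioc_eq_integral_Ioo]
  have hEu_int : IntegrableOn (fun s => (eGradNormSq (u s)).toReal) (Ioc 0 t) :=
    hIoc (integrable_toReal_of_lintegral_ne_top hu.aemeasurable_eGradNormSq hu.lintegral_eGradNormSq_lt_top.ne)
  have hEU_int : IntegrableOn (fun s => (eGradNormSq (U s)).toReal) (Ioc 0 t) :=
    (hEU_cont.integrableOn_Icc.mono_set (Icc_subset_Icc_right ht.2)).mono_set Ioc_subset_Icc_self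
  have hD : ∫ s in Ioc 0 t, ((eGradNormSq (u s)).toReal + (eGradNormSq (U s)).toReal +
      2 * ∫ x, ⟪u s x, FunctionSpaces.Torus.laplacian (U s) x⟫) =
      (∫ s in Ioc 0 t, (eGradNormSq (u s)).toReal) + (∫ s in Ioc 0 t, (eGradNormSq (U s)).toReal) +
        2 * ∫ s in Ioc 0 t, ∫ x, ⟪u s x, FunctionSpaces.Torus.laplacian (U s) x⟫ := by
    have j1 : IntegrableOn (fun s => (eGradNormSq (u s)).toReal + (eGradNormSq (U s)).toReal) (Ioc 0 t) :=
      hEu_int.add hEU_int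
    rw [integral_add j1 (hL_int.const_mul _), integral_add hEu_int hEU_int, integral_const_mul]
  -- the force difference and the right-hand side
  have hΦf : ∫ s in Ioc 0 t, ((∫ x, ⟪f x - G x, u s x⟫) -
      (∫ x, ⟪u s x - U s x, FunctionSpaces.Torus.convect (u s - U s) (U s) x⟫) -
      ∫ x, ⟪u s x - Pu s x, FunctionSpaces.Torus.convect (U s) (U s) x⟫) =
      ((∫ s in Ioc 0 t, ∫ x, ⟪f x, u s x⟫) - ∫ s in Ioc 0 t, ∫ x, ⟪G x, u s x⟫) -
        (∫ s in Ioc 0 t, ∫ x, ⟪u s x - U s x, FunctionSpaces.Torus.convect (u s - U s) (U s) x⟫) -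
        ∫ s in Ioc 0 t, ∫ x, ⟪u s x - Pu s x, FunctionSpaces.Torus.convect (U s) (U s) x⟫ := by
    have hsub : ∀ s ∈ Ioc 0 t, (∫ x, ⟪f x - G x, u s x⟫) = (∫ x, ⟪f x, u s x⟫) - ∫ x, ⟪G x, u s x⟫ := by
      intro s hs
      have i1 : Integrable (fun x => ⟪f x, u s x⟫) volume :=
        (integrable_inner_of_continuous ((hmem s hs).integrable one_le_two) hf.continuous).congr
          (ae_of_all _ fun x => real_inner_comm _ _)
      have i2 : Integrable (fun x => ⟪G x, u s x⟫) volume :=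
        (integrable_inner_of_continuous ((hmem s hs).integrable one_le_two) hG.continuous).congr
          (ae_of_all _ fun x => real_inner_comm _ _)
      rw [← integral_sub i1 i2]
      exact integral_congr_ae (ae_of_all _ fun x => inner_sub_left _ _ _)
    have hΦf_int : IntegrableOn (fun s => ∫ x, ⟪f x - G x, u s x⟫) (Ioc 0 t) :=
      (hΦ1_int.sub hΦG_int).congr_fun (fun s hs => (hsub s hs).symm) measurableSet_Ioc
    have j1 : IntegrableOn (fun s => (∫ x, ⟪f x - G x, u s x⟫) -
        ∫ x, ⟪u s x - U s x, FunctionSpaces.Torus.convect (u s - U s) (U s) x⟫) (Ioc 0 t) := hΦf_int.sub hB1_int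
    rw [integral_sub j1 hB2_int, integral_sub hΦf_int hB1_int,
      setIntegral_congr_fun measurableSet_Ioc hsub, integral_sub hΦ1_int hΦG_int]
  -- (11) assemble
  have hWt : ∫ x, ‖u t x - U t x‖ ^ 2 = (∫ x, ‖u t x‖ ^ 2) - 2 * (∫ x, ⟪u t x, U t x⟫) + ∫ x, ‖U t x‖ ^ 2 :=
    integral_norm_sub_sq_eq (hmem t ⟨ht.1, le_rfl⟩) (hUs t).continuous
  have hW0 : ∫ x, ‖u₀ x - U 0 x‖ ^ 2 = (∫ x, ‖u₀ x‖ ^ 2) - 2 * (∫ x, ⟪u₀ x, U 0 x⟫) + ∫ x, ‖U 0 x‖ ^ 2 :=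
    integral_norm_sub_sq_eq hu₀ (hUs 0).continuous
  simp only [FunctionSpaces.Torus.kineticEnergy, intervalIntegral.integral_of_le ht.1.le] at hE1 hE2
  rw [hDu] at hE1
  rw [hDU] at hE2
  rw [hXint] at hXt
  rw [hWt, hW0, hD, hΦf]
  linarith [hE1, hE2, hXt]

end Difference

end Literature.Analysis.FluidPDE
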